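import Mathlib.MeasureTheory.Group.FundamentalDomain
import Mathlib.MeasureTheory.Group.Measure
import Mathlib.MeasureTheory.Group.MeasurableEquiv
import Mathlib.LinearAlgebra.Dual.Lemmas
import Literature.NumberTheory.Automorphic.AutomorphicForms
import Literature.NumberTheory.Automorphic.GlobalAdditiveCharacter
import Literature.NumberTheory.Automorphic.WhittakerTwistedJacquet
import HarnessLib

/-!
# Fourier coefficients along an abelianised unipotent radical, twisted Jacquet modules
# `J_{U,ψ_x}`, and the wave-front support; the quintic (`E₈ ⊃ P_{α₅}`, `4 ⊗ ∧²5`) instance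

Topic `NumberTheory/Automorphic`; namespace `Literature.NumberTheory.Automorphic`. Definition
request `defn-QuinticFourierCoefficientAndWavefront` (route `E8QuinticResidue`, crux
`ExceptionalFourierSupport`, items K1/K2). The route needs, for the split group `E₈` over `ℚ`, its
maximal parabolic `P = P_{α₅} = M U` (Levi `A₄ + A₃`, unipotent radical `U` graded
`(40, 30, 20, 10, 4)`, `U/[U,U] = 𝔲₁ = 4 ⊗ ∧²5`, Bhargava's space of quintic rings):

* (A, GLOBAL) the Fourier coefficient `F_x(φ)(g) = ∫_{U(ℚ)\U(𝔸)} φ(u g) ψ_x(u)⁻¹ du` of an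
  automorphic form `φ` on `E₈(ℚ)\E₈(𝔸)` with respect to the character `ψ_x = ψ ∘ ⟨x, log u mod
  [U,U]⟩` of `U(𝔸)` attached to a rational point `x` of the dual of `(U/[U,U])(ℚ) = ℚ⁴ ⊗ ∧²ℚ⁵`,
  the predicate "`F_x` does not vanish identically on the automorphic representation `R`", and
  the wave-front notion "some non-degenerate `x` has `F_x ≢ 0` on `R`";
* (B, LOCAL) for a smooth representation `J` of `E₈(ℚ_p)` the twisted Jacquet module
  `J_{U, ψ_x}` and the predicate `J_{U,ψ_x} ≠ 0`;
* (C) the glue "`F_x ≢ 0` on `R` implies that the local component `R_p` supports `ψ_x`".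

There is no split `E₈`, no parabolic `P_{α₅}` and no Bhargava space in the tree yet (sibling
requests `defn-E8QuinticEisensteinDatum`, `defn-BhargavaQuinticSpace` are in flight), and nothing
in (A)–(C) is specific to `E₈`: they are the general notions of the *Fourier coefficient of an
automorphic form along the unipotent radical `U` of a parabolic with respect to a character of
`U(𝔸)` trivial on `U(K)` and on `[U, U]`* (Fleig–Gustafsson–Kleinschmidt–Persson 2018, Def. 6.6,
Prop. 6.9, Def. 6.13; the *orbit Fourier coefficient* attached to a nilpotent orbit, Def. 6.37,
is the case where `U = V_𝒪 = exp (⊕_{i ≥ 2} 𝔤_i)` for the Jacobson–Morozov grading and the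
character is given by an element of the dense Levi orbit on `𝔤_{-2}` — for the even orbit
`E₈(a₇)`, weighted Dynkin diagram `2` at `α₅` and `0` elsewhere (Miller 2012, as recorded by the
route; `dim E₈(a₇) = 208 = 248 - 40 = dim 𝔤 - dim 𝔤₀`), `V_𝒪` is all of `U_{P_{α₅}}` and
`𝔤₂ = 𝔲₁ = 4 ⊗ ∧²5`), of the global *wave-front set* (Jiang–Liu–Savin 2016, Introduction:
"the set of nilpotent `G(k)`-orbits such that this functional is non-trivial"), and of the local
*twisted co-invariants* `π_{N_u, ψ_u}` whose non-vanishing defines the `p`-adic wave-front set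
(Mœglin–Waldspurger 1987; Jiang–Liu–Savin 2016, Introduction and §5; Bernstein–Zelevinsky 1977,
§1.8 (b), the `θ`-localisation `r_{U,θ}`, which the tree has as `Representation.charTwist` /
`Representation.Coinvariants`, file `WhittakerTwistedJacquet`). So this file formalises the
general notions over the tree's axiomatic adelic datum `AdelicGroupData` (file `AdelicGroupData`)
and an explicit **abelianised unipotent datum** (below), and then names the quintic instance by
fixing the index set of coordinates to Bhargava's `QuinticIndex = Fin 4 × {j < k in Fin 5}`
(`|QuinticIndex| = 40 = dim 𝔲₁`, item `E8Alpha5Grading` of the route).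

## The datum

Characters of `U(𝔸)` trivial on `[U, U]` and on `U(K)` are parametrised by "mode numbers"
`x = (m_α)_{α ∈ Δ⁽¹⁾(𝔲)} ∈ K^{Δ⁽¹⁾(𝔲)}`, `Δ⁽¹⁾(𝔲)` the roots of `𝔲` not in `[𝔲, 𝔲]`, through
`ψ(∏ x_α(u_α) · [U,U]) = ψ_K(∑_α m_α u_α)` (Fleig et al. 2018, Prop. 6.9, (6.30); Jiang–Liu–Savin
2016, §5: `ψ_u(exp X) = ψ(κ(u, X))`). Accordingly an `AbelianUnipotentDatum G F ι` is a subgroup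
`U ≤ G` together with a homomorphism `coord : U → (F^ι, +)` — by intent `G = 𝐆(F)` or `𝐆(𝔸_K)`,
`U` the points of the unipotent radical of a parabolic `K`-subgroup, `ι = Δ⁽¹⁾(𝔲)` and
`coord u = (u_α)_α`, the isomorphism `U/[U,U] ≅ 𝔾_a^ι` (the degree-one part of `log u`, additive in
`u` by the Campbell–Hausdorff formula) — and the character attached to `x : ι → F` is
`u ↦ ψ(x ⬝ᵥ coord u)` (`AbelianUnipotentDatum.charFun`, `.char`). The adelic version
`AdelicAbelianUnipotentDatum 𝒢 ι` over `𝒢 : AdelicGroupData K` adds that rational points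
`U(K) = U ∩ G(K)` have coordinates in `K^ι` (so that `ψ_x`, `x ∈ K^ι`, is trivial on `U(K)` for a
global additive character `ψ`, `globalCharFun_eq_one_of_mem_rationalPoints`), and a
`LocalPiece` at a finite place `v` records the factor embedding `G(K_v) → G(𝔸_K)` with a compatible
local datum (coordinates embedded by the factor inclusion `adeleSingleHom K v : K_v → 𝔸_K`).

## Main definitions (all with bodies; no named fact is introduced)

* `AbelianUnipotentDatum.twistedJacquet 𝒰 ρ ψ x = J_{U,ψ_x}(ρ)`: the coinvariants of the tree's
  `ρ.charTwist U ψ_x` (Mathlib `Representation.Coinvariants`), i.e. `V / ⟨ρ(u) v - ψ_x(u) v⟩`;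
  `AbelianUnipotentDatum.SupportsCharacter 𝒰 ρ ψ x :↔ J_{U,ψ_x}(ρ) ≠ 0`.
* `AdelicAbelianUnipotentDatum.coeff 𝒰 ν 𝓕 ψ x φ g = (ν 𝓕)⁻¹ ∫_𝓕 φ(u g) conj ψ_x(u) dν(u)`, the
  Fourier coefficient (Fleig et al. 2018, (6.38)), with the compact quotient `U(K)\U(𝔸_K)` realised —
  exactly as the tree's `whittakerCoeff` (file `GlobalWhittakerCoefficient`) and `CuspConditionGL` —
  by a (Haar) measure `ν` on `U(𝔸_K)` and a measurable fundamental domain `𝓕` of the left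
  translation action of `U(K)`, normalised to total mass one;
  `AdelicAbelianUnipotentDatum.HasNonzeroCoeff 𝒰 ψ W x`: some `φ ∈ W` has `F_x(φ)(g) ≠ 0` for some
  `g` (for some bi-invariant Haar measure and measurable fundamental domain — the value does not
  depend on the domain, `coeff_eq_of_isFundamentalDomain`);
  `AdelicAbelianUnipotentDatum.WavefrontContains 𝒰 ψ generic W :↔ ∃ x ∈ generic, HasNonzeroCoeff`.
* Quintic names for the route: `QuinticIndex`, `quinticCoords`, `HasNonzeroQuinticCoefficient`,
  `WFContainsE8a7` (parametrised by the non-degeneracy predicate on `K⁴ ⊗ ∧²K⁵`, to be supplied by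
  `defn-BhargavaQuinticSpace`), `SupportsQuinticCharacter`.

## Main statements (all proved)

* `supportsCharacter_iff_exists_functional`: `J_{U,ψ_x}(ρ) ≠ 0` iff `ρ` has a non-zero
  `(U, ψ_x)`-quasi-invariant functional `Λ(ρ(u)v) = ψ_x(u) Λ(v)` (Bump 1997, proof of Prop. 4.4.4:
  Whittaker functionals are the dual of the twisted Jacquet module; Mœglin–Waldspurger 1987,
  degenerate Whittaker models).
* `SupportsCharacter.of_conj`: if `m ∈ G` normalises `U` and acts on coordinates through a matrix
  `A` then `J_{U,ψ_x} ≠ 0 → J_{U, ψ_{x ᵥ* A}} ≠ 0` (transport by `ρ(m)`; with `m⁻¹` this shows that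
  `SupportsCharacter` only depends on the orbit of `x` under the Levi, Fleig et al. 2018, (6.84)–(6.88)).
* `coeffIntegrand_smul`, `coeff_eq_of_isFundamentalDomain`: the integrand `u ↦ φ(u g) conj ψ_x(u)`
  is left `U(K)`-invariant for left `G(K)`-invariant `φ`, so the coefficient does not depend on the
  fundamental domain (Mathlib `IsFundamentalDomain.setIntegral_eq`).
* `coeff_rightTranslation`: `F_x(r(h) φ)(g) = F_x(φ)(g h)`.
* `coeff_mul_left` (Fleig et al. 2018, (6.39)): `F_x(φ)(u₀ g) = ψ_x(u₀) F_x(φ)(g)` for a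
  right-invariant `ν` (change of variables `u ↦ u u₀` to the fundamental domain `𝓕 u₀`); hence
  `coeff_rightTranslation_one`: `φ ↦ F_x(φ)(1)` is a `(U(𝔸_K), ψ_x)`-quasi-invariant functional.
* `supportsCharacter_of_localPiece` (the local–global glue (C), algebraic form): if a linear
  functional `Λ` on a space `W` of functions on `G(𝔸_K)`, vanishing on `W' ≤ W`, is
  `(U(K_v), ψ_x)`-quasi-invariant, and `f : V → W` intertwines a representation `ρ` of `G(K_v)` with
  right translation modulo `W'` (the shape of the tree's `AutomorphicRepData.HasLocalComponentAt`)
  with `Λ ∘ f ≠ 0`, then `ρ` supports `ψ_{x,v}`; and `supportsCharacter_of_coeff_ne_zero`: the same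
  with `Λ = F_x(·)(1)` (linear on left-invariant functions with integrable integrands, quasi-invariant
  by `coeff_rightTranslation_one`) — "`F_x ≢ 0` on `R = ⊗' R_v` implies `(R_v)_{U,ψ_x} ≠ 0`", the
  only remaining input being Flath's factorisation (which provides `f` with `F_x ∘ f ≠ 0`).

## Faithfulness caveat

The data structures record no axiom saying that `coord` is onto `F^ι` with kernel `[U, U]`, that
`U` is the unipotent radical of a parabolic, or that `ofLocal` is the factor embedding: as for the
tree's `AdelicGroupData` / `AutomorphyDatum`, the notions are meaningful for the honest instances
(for the route: split `E₈`, `U = U_{P_{α₅}}`, `coord` the `40` root coordinates of `𝔲₁ = 4 ⊗ ∧²5`)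
and can be junk for others (e.g. for `U = ⊥` every non-zero `ρ` "supports" every `ψ_x`); statements
quantifying over these predicates must therefore be made for the intended datum, not for all data.

## References

* P. Fleig, H. P. A. Gustafsson, A. Kleinschmidt, D. Persson, *Eisenstein series and automorphic
  representations*, Cambridge Stud. Adv. Math. 176, CUP (2018): Def. 6.6, Prop. 6.9 and (6.30),
  Def. 6.10, Def. 6.13 and (6.38)–(6.39), §6.4.1 (6.84)–(6.89), Def. 6.34, Def. 6.37 (held; PDF
  pp. 130–134, 143–149). [FleigEtAl2018]
* D. Jiang, B. Liu, G. Savin, *Raising nilpotent orbits in wave-front sets*, Represent. Theory 20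
  (2016), 419–450, Introduction and §5 (held: arXiv:1412.8742, pp. 3, 7). [JiangLiuSavin2016]
* C. Mœglin, J.-L. Waldspurger, *Modèles de Whittaker dégénérés pour des groupes `p`-adiques*,
  Math. Z. 196 (1987), 427–452 (not held; cited for the notion only). [MoeglinWaldspurger1987]
* D. Ginzburg, *Certain conjectures relating unipotent orbits to automorphic representations*,
  Israel J. Math. 151 (2006), 323–355 (not held; cited for the notion `𝒪_G(π)` only). [Ginzburg2006]
* W. T. Gan, B. Gross, G. Savin, *Fourier coefficients of modular forms on `G₂`*, Duke Math. J.
  115 (2002), 105–169 (the cubic analogue: coefficients along the Heisenberg parabolic of `G₂`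
  indexed by cubic rings). [GanGrossSavin2002]
* M. Bhargava, *Higher composition laws IV: The parametrization of quintic rings*, Ann. of Math.
  167 (2008), 53–94, §1 (the space `ℤ⁴ ⊗ ∧²ℤ⁵` of quadruples of alternating `5 × 5` matrices).
  [Bhargava2008]
* I. N. Bernstein, A. V. Zelevinsky, *Induced representations of reductive `p`-adic groups I*,
  Ann. Sci. ÉNS 10 (1977), §1.8 (b). [BernsteinZelevinskyASENS1977]
* D. Bump, *Automorphic forms and representations* (1997), §4.4, proof of Prop. 4.4.4. [Bump1997]
-/

noncomputable section

open scoped ComplexConjugate Pointwise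
open NumberField IsDedekindDomain MeasureTheory Matrix

namespace Literature.NumberTheory.Automorphic

/-! ### Bhargava's index set for `4 ⊗ ∧²5` -/

/-- **Bhargava's index set**: `Fin 4 × {(j, k) ∈ Fin 5 × Fin 5 | j < k}`, indexing the basis
`e_i ⊗ (e_j ∧ e_k)` of `R⁴ ⊗ ∧²R⁵` = quadruples `(A₁, …, A₄)` of alternating `5 × 5` matrices over
`R` (Bhargava 2008, §1), equivalently the `40` roots of `α₅`-degree one of `E₈` spanning
`𝔲₁ = 𝔲/[𝔲,𝔲]` for the parabolic `P_{α₅}` (route item `E8Alpha5Grading`). [cite: Bhargava2008, §1] -/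
abbrev QuinticIndex : Type := Fin 4 × {p : Fin 5 × Fin 5 // p.1 < p.2}

/-- `|QuinticIndex| = 4 · 10 = 40` (`= dim 𝔲₁` for `E₈ ⊃ P_{α₅}`). [cite: Bhargava2008, §1] -/
theorem card_quinticIndex : Fintype.card QuinticIndex = 40 := by
  decide

/-- The coordinates `(A_i)_{jk}`, `j < k`, of a quadruple `A = (A₁, …, A₄)` of `5 × 5` matrices
(alternating in applications): the coefficient of `e_i ⊗ (e_j ∧ e_k)` (Bhargava 2008, §1).
[cite: Bhargava2008, §1] -/
def quinticCoords {R : Type*} (A : Fin 4 → Matrix (Fin 5) (Fin 5) R) : QuinticIndex → R :=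
  fun i => A i.1 i.2.1.1 i.2.1.2

/-- Unfolding `quinticCoords`. [folklore] -/
@[simp] theorem quinticCoords_apply {R : Type*} (A : Fin 4 → Matrix (Fin 5) (Fin 5) R)
    (i : Fin 4) (p : {p : Fin 5 × Fin 5 // p.1 < p.2}) :
    quinticCoords A (i, p) = A i p.1.1 p.1.2 := rfl

/-! ### Abelianised unipotent data and the characters `ψ_x` -/

/-- An **abelianised unipotent datum** in a group `G` with coordinates in `F^ι`: a subgroup
`U ≤ G` and a homomorphism `coord : U → (ι → F)` to the additive group (hence trivial on
`[U, U]`). By intent `G = 𝐆(F)` (or `𝐆(𝔸_K)`), `U` the points of the unipotent radical of a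
parabolic subgroup, `ι = Δ⁽¹⁾(𝔲)` the roots of `𝔲` outside `[𝔲, 𝔲]` and `coord u = (u_α)_α` the
coordinates of `u` modulo `[U, U]` in the root basis of `𝔲₁ ≅ 𝔲/[𝔲,𝔲]` (Fleig et al. 2018, Prop. 6.9
and Remark 6.31; Jiang–Liu–Savin 2016, §5). [cite: FleigEtAl2018, Prop. 6.9, (6.30), Remark 6.31] -/
structure AbelianUnipotentDatum (G : Type*) [Group G] (F : Type*) [CommRing F] (ι : Type*) where
  /-- The subgroup `U ≤ G` (points of a unipotent radical). -/
  U : Subgroup G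
  /-- The additive coordinates `U → F^ι` of `U/[U, U]`. -/
  coord : ↥U →* Multiplicative (ι → F)

namespace AbelianUnipotentDatum

section Char

variable {G : Type*} [Group G] {F : Type*} [CommRing F] {ι : Type*}
variable (𝒰 : AbelianUnipotentDatum G F ι)

/-- The coordinate vector `coord u ∈ F^ι` of `u ∈ U` (additive notation). [folklore] -/
def coordFun (u : ↥𝒰.U) : ι → F := Multiplicative.toAdd (𝒰.coord u)

/-- `coord (u v) = coord u + coord v`. [folklore] -/
@[simp] theorem coordFun_mul (u v : ↥𝒰.U) : 𝒰.coordFun (u * v) = 𝒰.coordFun u + 𝒰.coordFun v := by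
  simp [coordFun]

/-- `coord 1 = 0`. [folklore] -/
@[simp] theorem coordFun_one : 𝒰.coordFun 1 = 0 := by
  simp [coordFun]

/-- `coord u⁻¹ = - coord u`. [folklore] -/
@[simp] theorem coordFun_inv (u : ↥𝒰.U) : 𝒰.coordFun u⁻¹ = -𝒰.coordFun u := by
  simp [coordFun]

variable [Fintype ι]

/-- The value `ψ_x(u) = ψ(x ⬝ᵥ coord u) = ψ(∑_α x_α u_α) ∈ ℂ` of the character of `U` attached to
`x ∈ F^ι` and an additive character `ψ` of `F` (Fleig et al. 2018, (6.30); Jiang–Liu–Savin 2016,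
§5, `ψ_u(exp X) = ψ(κ(u, X))`). [cite: FleigEtAl2018, Prop. 6.9, (6.30)] -/
def charFun (ψ : AddChar F Circle) (x : ι → F) (u : ↥𝒰.U) : ℂ :=
  ψ (x ⬝ᵥ 𝒰.coordFun u)

/-- Unfolding `charFun`. [folklore] -/
theorem charFun_apply (ψ : AddChar F Circle) (x : ι → F) (u : ↥𝒰.U) :
    𝒰.charFun ψ x u = ψ (x ⬝ᵥ 𝒰.coordFun u) := rfl

/-- `ψ_x(1) = 1`. [folklore] -/
@[simp] theorem charFun_one (ψ : AddChar F Circle) (x : ι → F) : 𝒰.charFun ψ x 1 = 1 := by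
  simp [charFun]

/-- `ψ_x(u v) = ψ_x(u) ψ_x(v)`: `ψ_x` is a character of `U` (trivial on `[U, U]`).
[cite: FleigEtAl2018, Def. 6.6, (6.22)] -/
theorem charFun_mul (ψ : AddChar F Circle) (x : ι → F) (u v : ↥𝒰.U) :
    𝒰.charFun ψ x (u * v) = 𝒰.charFun ψ x u * 𝒰.charFun ψ x v := by
  simp [charFun, dotProduct_add, AddChar.map_add_eq_mul]

/-- `ψ_x(u) ≠ 0`. [folklore] -/
theorem charFun_ne_zero (ψ : AddChar F Circle) (x : ι → F) (u : ↥𝒰.U) : 𝒰.charFun ψ x u ≠ 0 :=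
  Circle.coe_ne_zero _

/-- `|ψ_x(u)| = 1` (a unitary character). [cite: FleigEtAl2018, Def. 6.6] -/
@[simp] theorem norm_charFun (ψ : AddChar F Circle) (x : ι → F) (u : ↥𝒰.U) :
    ‖𝒰.charFun ψ x u‖ = 1 :=
  Circle.norm_coe _

/-- `ψ_x(u⁻¹) = conj ψ_x(u)`. [folklore] -/
theorem charFun_inv (ψ : AddChar F Circle) (x : ι → F) (u : ↥𝒰.U) :
    𝒰.charFun ψ x u⁻¹ = conj (𝒰.charFun ψ x u) := by
  rw [charFun_apply, charFun_apply, coordFun_inv, dotProduct_neg, AddChar.map_neg_eq_inv,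
    Circle.coe_inv, Complex.inv_eq_conj (Circle.norm_coe _)]

/-- `ψ_0 = 1`: the trivial character (whose coefficient is the constant term along `U`).
[cite: FleigEtAl2018, Def. 6.10 (ii), Def. 6.17] -/
@[simp] theorem charFun_zero (ψ : AddChar F Circle) (u : ↥𝒰.U) : 𝒰.charFun ψ 0 u = 1 := by
  simp [charFun]

/-- The character `ψ_x : U →* ℂˣ` attached to `x ∈ F^ι` (values `charFun`), in the shape consumed
by the tree's `Representation.charTwist`. [cite: FleigEtAl2018, Prop. 6.9, (6.30)] -/
def char (ψ : AddChar F Circle) (x : ι → F) : ↥𝒰.U →* ℂˣ where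
  toFun u := Units.mk0 (𝒰.charFun ψ x u) (𝒰.charFun_ne_zero ψ x u)
  map_one' := Units.ext (by rw [Units.val_mk0, charFun_one, Units.val_one])
  map_mul' u v := Units.ext (by
    rw [Units.val_mk0, charFun_mul, Units.val_mul, Units.val_mk0, Units.val_mk0])

/-- `(ψ_x u : ℂ) = charFun`. [folklore] -/
@[simp] theorem coe_char (ψ : AddChar F Circle) (x : ι → F) (u : ↥𝒰.U) :
    (𝒰.char ψ x u : ℂ) = 𝒰.charFun ψ x u := rfl

end Char

/-! ### The twisted Jacquet module `J_{U,ψ_x}(ρ)` and the predicate `SupportsCharacter` -/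

section Jacquet

variable {G : Type*} [Group G] {F : Type*} [CommRing F] {ι : Type*} [Fintype ι]
variable (𝒰 : AbelianUnipotentDatum G F ι)
variable {V : Type*} [AddCommGroup V] [Module ℂ V]

/-- The **twisted Jacquet module** `J_{U,ψ_x}(ρ) = V / V(U, ψ_x)`, `V(U, ψ_x) = ⟨ρ(u) v - ψ_x(u) v⟩`,
of a representation `ρ` of `G` on `V` along `U` with respect to `ψ_x` (the twisted co-invariants
`π_{N_u,ψ_u}` of Jiang–Liu–Savin 2016, Introduction; Mœglin–Waldspurger 1987; Bernstein–Zelevinsky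
1977, §1.8 (b), `r_{U,θ}`): the Mathlib coinvariants of the tree's `ρ.charTwist U ψ_x`.
[cite: JiangLiuSavin2016, Introduction and §5] -/
abbrev twistedJacquet (ρ : Representation ℂ G V) (ψ : AddChar F Circle) (x : ι → F) : Type _ :=
  (ρ.charTwist 𝒰.U (𝒰.char ψ x)).Coinvariants

/-- `ρ` **supports the character `ψ_x` of `U`**: `J_{U,ψ_x}(ρ) ≠ 0` (so that, for `x` in a nilpotent
orbit `𝒪`, `𝒪` lies in the wave-front set of `ρ`: Jiang–Liu–Savin 2016, Introduction; Fleig et al.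
2018, Def. 6.34). [cite: JiangLiuSavin2016, Introduction] -/
def SupportsCharacter (ρ : Representation ℂ G V) (ψ : AddChar F Circle) (x : ι → F) : Prop :=
  Nontrivial (𝒰.twistedJacquet ρ ψ x)

variable (ρ : Representation ℂ G V) (ψ : AddChar F Circle) (x : ι → F)

/-- `ρ(u) v - ψ_x(u) v ∈ V(U, ψ_x)`. [cite: BernsteinZelevinskyASENS1977, §1.8 (b)] -/
theorem sub_smul_mem_ker (u : ↥𝒰.U) (v : V) :
    ρ (u : G) v - 𝒰.charFun ψ x u • v ∈
      Representation.Coinvariants.ker (ρ.charTwist 𝒰.U (𝒰.char ψ x)) := by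
  have h := Representation.sub_smul_mem_ker_charTwist ρ 𝒰.U (𝒰.char ψ x) u v
  rwa [Units.smul_def, coe_char] at h

/-- In `J_{U,ψ_x}(ρ)`: `[ρ(u) v] = ψ_x(u) [v]`. [folklore] -/
theorem mk_apply (u : ↥𝒰.U) (v : V) :
    Representation.Coinvariants.mk (ρ.charTwist 𝒰.U (𝒰.char ψ x)) (ρ (u : G) v) =
      𝒰.charFun ψ x u • Representation.Coinvariants.mk (ρ.charTwist 𝒰.U (𝒰.char ψ x)) v := by
  rw [Representation.coinvariantsMk_charTwist_apply, Units.smul_def, coe_char]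

/-- `V(U, ψ_x)` is spanned by the `ρ(u) v - ψ_x(u) v` (Bump 1997, §4.4: `V_{N,ψ}`).
[cite: Bump1997, §4.4 (PDF p. 462)] -/
theorem ker_eq_span :
    Representation.Coinvariants.ker (ρ.charTwist 𝒰.U (𝒰.char ψ x)) =
      Submodule.span ℂ (Set.range fun p : ↥𝒰.U × V => ρ (p.1 : G) p.2 - 𝒰.charFun ψ x p.1 • p.2) := by
  rw [Representation.ker_charTwist_eq_span]
  simp only [Units.smul_def, coe_char]

/-- `J_{U,ψ_x}(ρ) ≠ 0` iff some vector has non-zero image in it. [folklore] -/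
theorem supportsCharacter_iff_exists_mk_ne_zero :
    𝒰.SupportsCharacter ρ ψ x ↔
      ∃ v : V, Representation.Coinvariants.mk (ρ.charTwist 𝒰.U (𝒰.char ψ x)) v ≠ 0 := by
  rw [SupportsCharacter, nontrivial_iff_exists_ne (0 : 𝒰.twistedJacquet ρ ψ x)]
  constructor
  · rintro ⟨y, hy⟩
    obtain ⟨v, rfl⟩ := Representation.Coinvariants.mk_surjective _ y
    exact ⟨v, hy⟩
  · rintro ⟨v, hv⟩
    exact ⟨_, hv⟩

/-- **`J_{U,ψ_x}(ρ) ≠ 0` iff `ρ` admits a non-zero `(U, ψ_x)`-quasi-invariant linear functional**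
`Λ(ρ(u) v) = ψ_x(u) Λ(v)` (a degenerate Whittaker functional): such functionals are exactly the
linear forms on `J_{U,ψ_x}(ρ)` (Bump 1997, proof of Prop. 4.4.4, p. 462; Mœglin–Waldspurger 1987),
and a non-zero complex vector space has a non-zero linear form. [cite: Bump1997, Prop. 4.4.4 (proof) (PDF p. 462)] -/
theorem supportsCharacter_iff_exists_functional :
    𝒰.SupportsCharacter ρ ψ x ↔
      ∃ Λ : V →ₗ[ℂ] ℂ, Λ ≠ 0 ∧ ∀ (u : ↥𝒰.U) (v : V), Λ (ρ (u : G) v) = 𝒰.charFun ψ x u * Λ v := by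
  rw [supportsCharacter_iff_exists_mk_ne_zero]
  constructor
  · rintro ⟨v, hv⟩
    obtain ⟨μ, hμ⟩ := Module.Projective.exists_dual_ne_zero ℂ hv
    refine ⟨μ ∘ₗ Representation.Coinvariants.mk _, fun h => hμ ?_, fun u w => ?_⟩
    · have := LinearMap.congr_fun h v
      simpa using this
    · rw [LinearMap.comp_apply, LinearMap.comp_apply, mk_apply, map_smul, smul_eq_mul]
  · rintro ⟨Λ, hΛ0, hΛ⟩
    have hinv : ∀ u : ↥𝒰.U, Λ ∘ₗ (ρ.charTwist 𝒰.U (𝒰.char ψ x)) u = Λ := fun u =>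
      LinearMap.ext fun v => by
        rw [LinearMap.comp_apply, Representation.charTwist_apply, Units.smul_def, map_smul, hΛ u v,
          smul_eq_mul, Units.val_inv_eq_inv_val, coe_char,
          inv_mul_cancel_left₀ (𝒰.charFun_ne_zero ψ x u)]
    by_contra h
    push Not at h
    apply hΛ0
    ext v
    have := Representation.Coinvariants.lift_mk (ρ.charTwist 𝒰.U (𝒰.char ψ x)) Λ hinv v
    rw [← this, h v, map_zero, LinearMap.zero_apply]

/-- A representation supporting `ψ_x` is non-zero. [folklore] -/
theorem SupportsCharacter.nontrivial {𝒰 : AbelianUnipotentDatum G F ι} {ρ : Representation ℂ G V}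
    {ψ : AddChar F Circle} {x : ι → F} (h : 𝒰.SupportsCharacter ρ ψ x) : Nontrivial V := by
  obtain ⟨v, hv⟩ := (𝒰.supportsCharacter_iff_exists_mk_ne_zero ρ ψ x).1 h
  exact nontrivial_of_ne v 0 (by rintro rfl; exact hv (map_zero _))

/-- **Transport along the Levi.** If `m ∈ G` normalises `U` and conjugation by `m` acts on the
coordinates through a matrix `A` (`coord (m u m⁻¹) = A · coord u`), then
`J_{U,ψ_x}(ρ) ≠ 0 → J_{U,ψ_{x A}}(ρ) ≠ 0` (`x A = x ᵥ* A`, so that `ψ_{x A}(u) = ψ_x(m u m⁻¹)`): the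
functional `Λ ∘ ρ(m)` is `(U, ψ_{xA})`-quasi-invariant when `Λ` is `(U, ψ_x)`-quasi-invariant.
Applied to `m⁻¹` (matrix `A⁻¹`) this gives the converse, so `SupportsCharacter ρ ψ x` only depends on
the orbit of `x` under the (dual) action of the Levi (Fleig et al. 2018, (6.84)–(6.88): `ψ^γ(u) =
ψ(γ u γ⁻¹)`, "it suffices to calculate the Fourier coefficient of one representative of an orbit").
[cite: FleigEtAl2018, §6.4.1, (6.84)–(6.88)] -/
theorem SupportsCharacter.of_conj {𝒰 : AbelianUnipotentDatum G F ι} {ρ : Representation ℂ G V}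
    {ψ : AddChar F Circle} {x : ι → F} (h : 𝒰.SupportsCharacter ρ ψ x) (m : G)
    (hm : ∀ u : ↥𝒰.U, m * u * m⁻¹ ∈ 𝒰.U) (A : Matrix ι ι F)
    (hA : ∀ u : ↥𝒰.U, 𝒰.coordFun ⟨m * u * m⁻¹, hm u⟩ = A *ᵥ 𝒰.coordFun u) :
    𝒰.SupportsCharacter ρ ψ (x ᵥ* A) := by
  rw [supportsCharacter_iff_exists_functional] at h ⊢
  obtain ⟨Λ, hΛ0, hΛ⟩ := h
  refine ⟨Λ ∘ₗ ρ m, fun h0 => hΛ0 ?_, fun u v => ?_⟩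
  · ext v
    have := LinearMap.congr_fun h0 (ρ m⁻¹ v)
    simpa [← Module.End.mul_apply, ← map_mul] using this
  · have hconj : ρ m (ρ (u : G) v) = ρ ((⟨m * u * m⁻¹, hm u⟩ : ↥𝒰.U) : G) (ρ m v) := by
      simp only [← Module.End.mul_apply, ← map_mul]
      congr 1
      group
    rw [LinearMap.comp_apply, LinearMap.comp_apply, hconj, hΛ, charFun_apply, charFun_apply, hA,
      dotProduct_mulVec]

end Jacquet

end AbelianUnipotentDatum

/-! ### The adelic datum, the characters `ψ_x` (`x ∈ K^ι`) and the Fourier coefficients -/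

section Global

variable {K : Type} [Field K] [NumberField K]

/-- An **adelic abelianised unipotent datum** on `𝒢 : AdelicGroupData K`: an abelianised unipotent
datum `(U ≤ G(𝔸_K), coord : U → 𝔸_K^ι)` whose rational points `U(K) = U ∩ G(K)` have rational
coordinates. By intent `U = 𝐔(𝔸_K)` for the unipotent radical `𝐔` of a parabolic `K`-subgroup of
`𝐆` and `coord` the `K`-isomorphism `𝐔/[𝐔,𝐔] ≅ 𝔾_a^ι` on adelic points (Fleig et al. 2018, Def. 6.6
and Prop. 6.9: characters of `U(𝔸)` trivial on `U(ℚ) = U(𝔸) ∩ G(ℚ)` are the `ψ(∑ m_α u_α)`,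
`m_α ∈ ℚ`). [cite: FleigEtAl2018, Def. 6.6, Prop. 6.9] -/
structure AdelicAbelianUnipotentDatum (𝒢 : AdelicGroupData K) (ι : Type*) extends
    AbelianUnipotentDatum 𝒢.Adelic (AdeleRing (𝓞 K) K) ι where
  /-- Rational points of `U` have coordinates in `K^ι ⊆ 𝔸_K^ι`. -/
  exists_coord_eq_algebraMap : ∀ u : ↥U, (u : 𝒢.Adelic) ∈ 𝒢.arithmeticSubgroup →
    ∃ y : ι → K, Multiplicative.toAdd (coord u) = fun i => algebraMap K (AdeleRing (𝓞 K) K) (y i)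

namespace AdelicAbelianUnipotentDatum

variable {𝒢 : AdelicGroupData K} {ι : Type*} (𝒰 : AdelicAbelianUnipotentDatum 𝒢 ι)

/-- `U(K) = U ∩ G(K) ≤ U(𝔸_K)`: the rational points of `U`, a discrete cocompact subgroup
(Fleig et al. 2018, Def. 6.6). [cite: FleigEtAl2018, Def. 6.6] -/
def rationalPoints : Subgroup ↥𝒰.U := 𝒢.arithmeticSubgroup.comap 𝒰.U.subtype

/-- Membership in `rationalPoints`. [folklore] -/
theorem mem_rationalPoints_iff (u : ↥𝒰.U) :
    u ∈ 𝒰.rationalPoints ↔ (u : 𝒢.Adelic) ∈ 𝒢.arithmeticSubgroup := Iff.rfl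

/-- Rational points have rational coordinates. [cite: FleigEtAl2018, Prop. 6.9] -/
theorem exists_coordFun_eq_of_mem_rationalPoints {u : ↥𝒰.U} (hu : u ∈ 𝒰.rationalPoints) :
    ∃ y : ι → K, 𝒰.coordFun u = fun i => algebraMap K (AdeleRing (𝓞 K) K) (y i) :=
  𝒰.exists_coord_eq_algebraMap u hu

/-- The rational coordinate vector `x ∈ K^ι` viewed in `𝔸_K^ι`. [folklore] -/
def adelicCoords (x : ι → K) : ι → AdeleRing (𝓞 K) K :=
  fun i => algebraMap K (AdeleRing (𝓞 K) K) (x i)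

/-- Unfolding `adelicCoords`. [folklore] -/
@[simp] theorem adelicCoords_apply (x : ι → K) (i : ι) :
    adelicCoords x i = algebraMap K (AdeleRing (𝓞 K) K) (x i) := rfl

section CharGlobal

variable [Fintype ι]

/-- The value `ψ_x(u) = ψ(∑_α x_α u_α)` of the **global character attached to `x ∈ K^ι`** and an
additive character `ψ` of `𝔸_K` (Fleig et al. 2018, (6.30) with mode numbers `m_α = x_α ∈ ℚ`).
[cite: FleigEtAl2018, Prop. 6.9, (6.30)] -/
def globalCharFun (ψ : AddChar (AdeleRing (𝓞 K) K) Circle) (x : ι → K) (u : ↥𝒰.U) : ℂ :=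
  𝒰.charFun ψ (adelicCoords x) u

/-- `globalCharFun` is `charFun` at the adelic image of `x`. [folklore] -/
theorem globalCharFun_eq (ψ : AddChar (AdeleRing (𝓞 K) K) Circle) (x : ι → K) (u : ↥𝒰.U) :
    𝒰.globalCharFun ψ x u = 𝒰.charFun ψ (adelicCoords x) u := rfl

/-- The global character `ψ_x : U(𝔸_K) →* ℂˣ`. [cite: FleigEtAl2018, Prop. 6.9, (6.30)] -/
abbrev globalChar (ψ : AddChar (AdeleRing (𝓞 K) K) Circle) (x : ι → K) : ↥𝒰.U →* ℂˣ :=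
  𝒰.char ψ (adelicCoords x)

/-- `ψ_x(u v) = ψ_x(u) ψ_x(v)`. [folklore] -/
theorem globalCharFun_mul (ψ : AddChar (AdeleRing (𝓞 K) K) Circle) (x : ι → K) (u v : ↥𝒰.U) :
    𝒰.globalCharFun ψ x (u * v) = 𝒰.globalCharFun ψ x u * 𝒰.globalCharFun ψ x v :=
  𝒰.charFun_mul ψ _ u v

/-- **`ψ_x` is trivial on `U(K)`** for a global additive character `ψ` (trivial on `K`) and
`x ∈ K^ι`: the argument `∑ x_α u_α` is a principal adele (Fleig et al. 2018, Def. 6.6 and Prop. 6.9).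
[cite: FleigEtAl2018, Def. 6.6, Prop. 6.9] -/
theorem globalCharFun_eq_one_of_mem_rationalPoints {ψ : AddChar (AdeleRing (𝓞 K) K) Circle}
    (hψ : IsGlobalAddChar K ψ) (x : ι → K) {u : ↥𝒰.U} (hu : u ∈ 𝒰.rationalPoints) :
    𝒰.globalCharFun ψ x u = 1 := by
  obtain ⟨y, hy⟩ := 𝒰.exists_coordFun_eq_of_mem_rationalPoints hu
  have hsum : adelicCoords x ⬝ᵥ 𝒰.coordFun u = algebraMap K (AdeleRing (𝓞 K) K) (x ⬝ᵥ y) := by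
    simp only [dotProduct, hy, adelicCoords_apply, map_sum, map_mul]
  rw [globalCharFun, AbelianUnipotentDatum.charFun_apply, hsum, hψ.map_algebraMap, Circle.coe_one]

section Coeff

variable [MeasurableSpace ↥𝒰.U]

/-- **The Fourier coefficient of `φ : G(𝔸_K) → ℂ` along `U` with respect to `ψ_x`** (Fleig et al.
2018, Def. 6.13, (6.38): `F_ψ(φ, g) = ∫_{U(ℚ)\U(𝔸)} φ(u g) conj ψ(u) du`; for `x = 0` the constant
term along `U`, Def. 6.17), with the compact quotient `U(K)\U(𝔸_K)` realised, as in the tree's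
`whittakerCoeff` and `CuspConditionGL`, by a measure `ν` on `U(𝔸_K)` (Haar in applications) and a
measurable fundamental domain `𝓕 ⊆ U(𝔸_K)` of the left translation action of `U(K)`
(`rationalPoints`), normalised to total mass one:
`coeff ν 𝓕 ψ x φ g = (ν 𝓕)⁻¹ ∫_𝓕 φ(u g) conj ψ_x(u) dν(u)`. For left `G(K)`-invariant `φ` and global
`ψ` the value does not depend on `𝓕` (`coeff_eq_of_isFundamentalDomain`). Junk value `0` when
`ν 𝓕 ∈ {0, ∞}`. [cite: FleigEtAl2018, Def. 6.13, (6.38)] -/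
def coeff (ν : Measure ↥𝒰.U) (𝓕 : Set ↥𝒰.U) (ψ : AddChar (AdeleRing (𝓞 K) K) Circle) (x : ι → K)
    (φ : 𝒢.Adelic → ℂ) (g : 𝒢.Adelic) : ℂ :=
  ((ν 𝓕).toReal⁻¹ : ℝ) • ∫ u in 𝓕, φ ((u : 𝒢.Adelic) * g) * conj (𝒰.globalCharFun ψ x u) ∂ν

/-- Unfolding `coeff`. [folklore] -/
theorem coeff_def (ν : Measure ↥𝒰.U) (𝓕 : Set ↥𝒰.U) (ψ : AddChar (AdeleRing (𝓞 K) K) Circle)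
    (x : ι → K) (φ : 𝒢.Adelic → ℂ) (g : 𝒢.Adelic) :
    𝒰.coeff ν 𝓕 ψ x φ g = ((ν 𝓕).toReal⁻¹ : ℝ) •
      ∫ u in 𝓕, φ ((u : 𝒢.Adelic) * g) * conj (𝒰.globalCharFun ψ x u) ∂ν := rfl

/-- The coefficient of `0` is `0`. [folklore] -/
@[simp] theorem coeff_zero (ν : Measure ↥𝒰.U) (𝓕 : Set ↥𝒰.U)
    (ψ : AddChar (AdeleRing (𝓞 K) K) Circle) (x : ι → K) (g : 𝒢.Adelic) :
    𝒰.coeff ν 𝓕 ψ x (0 : 𝒢.Adelic → ℂ) g = 0 := by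
  simp [coeff]

/-- `coeff` is additive in `φ` (given integrability on `𝓕`). [folklore] -/
theorem coeff_add (ν : Measure ↥𝒰.U) (𝓕 : Set ↥𝒰.U) (ψ : AddChar (AdeleRing (𝓞 K) K) Circle)
    (x : ι → K) {φ₁ φ₂ : 𝒢.Adelic → ℂ} (g : 𝒢.Adelic)
    (h₁ : IntegrableOn (fun u : ↥𝒰.U => φ₁ ((u : 𝒢.Adelic) * g) * conj (𝒰.globalCharFun ψ x u)) 𝓕 ν)
    (h₂ : IntegrableOn (fun u : ↥𝒰.U => φ₂ ((u : 𝒢.Adelic) * g) * conj (𝒰.globalCharFun ψ x u)) 𝓕 ν) :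
    𝒰.coeff ν 𝓕 ψ x (φ₁ + φ₂) g = 𝒰.coeff ν 𝓕 ψ x φ₁ g + 𝒰.coeff ν 𝓕 ψ x φ₂ g := by
  simp only [coeff, Pi.add_apply, add_mul]
  rw [integral_add h₁ h₂, smul_add]

/-- `coeff` is homogeneous in `φ`. [folklore] -/
theorem coeff_const_smul (ν : Measure ↥𝒰.U) (𝓕 : Set ↥𝒰.U)
    (ψ : AddChar (AdeleRing (𝓞 K) K) Circle) (x : ι → K) (c : ℂ) (φ : 𝒢.Adelic → ℂ)
    (g : 𝒢.Adelic) : 𝒰.coeff ν 𝓕 ψ x (c • φ) g = c * 𝒰.coeff ν 𝓕 ψ x φ g := by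
  simp only [coeff, Pi.smul_apply, smul_eq_mul, mul_assoc, integral_const_mul, Complex.real_smul]
  ring

/-- **`F_x(r(h) φ)(g) = F_x(φ)(g h)`**: the coefficient intertwines right translation
(`rightTranslation`, file `AutomorphicForms`) with right translation of the argument.
[cite: FleigEtAl2018, Remark 6.14] -/
theorem coeff_rightTranslation (ν : Measure ↥𝒰.U) (𝓕 : Set ↥𝒰.U)
    (ψ : AddChar (AdeleRing (𝓞 K) K) Circle) (x : ι → K) (φ : 𝒢.Adelic → ℂ) (h g : 𝒢.Adelic) :
    𝒰.coeff ν 𝓕 ψ x (rightTranslation 𝒢 h φ) g = 𝒰.coeff ν 𝓕 ψ x φ (g * h) := by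
  simp only [coeff, rightTranslation_apply, mul_assoc]

omit [MeasurableSpace ↥𝒰.U] in
/-- **`U(K)`-invariance of the integrand.** For `φ` left `G(K)`-invariant (`IsLeftInvariant`), `ψ`
global and `γ ∈ U(K)`: `φ((γ u) g) conj ψ_x(γ u) = φ(u g) conj ψ_x(u)`, so `u ↦ φ(u g) conj ψ_x(u)`
is a function on `U(K)\U(𝔸_K)` (Fleig et al. 2018, Def. 6.13). [cite: FleigEtAl2018, Def. 6.13] -/
theorem coeffIntegrand_smul {ψ : AddChar (AdeleRing (𝓞 K) K) Circle} (hψ : IsGlobalAddChar K ψ)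
    (x : ι → K) {φ : 𝒢.Adelic → ℂ} (hφ : IsLeftInvariant 𝒢 φ) (g : 𝒢.Adelic)
    (γ : ↥𝒰.rationalPoints) (u : ↥𝒰.U) :
    φ (((γ • u : ↥𝒰.U)) * g) * conj (𝒰.globalCharFun ψ x (γ • u)) =
      φ ((u : 𝒢.Adelic) * g) * conj (𝒰.globalCharFun ψ x u) := by
  have hγu : (γ • u : ↥𝒰.U) = (γ : ↥𝒰.U) * u := rfl
  rw [hγu, globalCharFun_mul, 𝒰.globalCharFun_eq_one_of_mem_rationalPoints hψ x γ.2, one_mul,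
    Subgroup.coe_mul, mul_assoc]
  congr 1
  exact hφ _ γ.2 _

/-- Hence the coefficient of a left `G(K)`-invariant `φ` **does not depend on the fundamental
domain**: two measurable fundamental domains of `U(K)` in `U(𝔸_K)` for an invariant measure give the
same integral (Mathlib `IsFundamentalDomain.setIntegral_eq`) and the same mass
(`IsFundamentalDomain.measure_eq`). [folklore] -/
theorem coeff_eq_of_isFundamentalDomain [Countable ↥𝒰.rationalPoints] {ν : Measure ↥𝒰.U}
    [MeasurableConstSMul ↥𝒰.rationalPoints ↥𝒰.U] [SMulInvariantMeasure ↥𝒰.rationalPoints ↥𝒰.U ν]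
    {𝓕 𝓕' : Set ↥𝒰.U} (h𝓕 : IsFundamentalDomain ↥𝒰.rationalPoints 𝓕 ν)
    (h𝓕' : IsFundamentalDomain ↥𝒰.rationalPoints 𝓕' ν)
    {ψ : AddChar (AdeleRing (𝓞 K) K) Circle} (hψ : IsGlobalAddChar K ψ) (x : ι → K)
    {φ : 𝒢.Adelic → ℂ} (hφ : IsLeftInvariant 𝒢 φ) (g : 𝒢.Adelic) :
    𝒰.coeff ν 𝓕 ψ x φ g = 𝒰.coeff ν 𝓕' ψ x φ g := by
  rw [coeff, coeff, h𝓕.measure_eq h𝓕',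
    h𝓕.setIntegral_eq h𝓕' (f := fun u : ↥𝒰.U =>
      φ ((u : 𝒢.Adelic) * g) * conj (𝒰.globalCharFun ψ x u))
      (fun γ u => 𝒰.coeffIntegrand_smul hψ x hφ g γ u)]

/-- **`F_x(φ)(u₀ g) = ψ_x(u₀) F_x(φ)(g)`** (Fleig et al. 2018, (6.39)): the Fourier coefficient of a
left `G(K)`-invariant `φ` is `(U(𝔸_K), ψ_x)`-quasi-invariant on the left, for a right-invariant
measure `ν` (Haar measure on the unimodular group `U(𝔸_K)`) and a fundamental domain `𝓕` of
`U(K)`: substituting `u ↦ u u₀` (measure-preserving) moves the integral to the fundamental domain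
`𝓕 u₀`, over which the `U(K)`-invariant integrand has the same integral
(`IsFundamentalDomain.setIntegral_eq`), and `conj ψ_x(u u₀⁻¹) = conj ψ_x(u) ψ_x(u₀)`. With
`coeff_rightTranslation` at `g = 1`: `F_x(r(u₀) φ)(1) = ψ_x(u₀) F_x(φ)(1)`, i.e. `φ ↦ F_x(φ)(1)` is a
`(U(𝔸_K), ψ_x)`-quasi-invariant functional. [cite: FleigEtAl2018, Def. 6.13, (6.39)] -/
theorem coeff_mul_left [BorelSpace ↥𝒰.U] [Countable ↥𝒰.rationalPoints] {ν : Measure ↥𝒰.U}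
    [ν.IsMulRightInvariant] [MeasurableConstSMul ↥𝒰.rationalPoints ↥𝒰.U]
    [SMulInvariantMeasure ↥𝒰.rationalPoints ↥𝒰.U ν] {𝓕 : Set ↥𝒰.U}
    (h𝓕 : IsFundamentalDomain ↥𝒰.rationalPoints 𝓕 ν) {ψ : AddChar (AdeleRing (𝓞 K) K) Circle}
    (hψ : IsGlobalAddChar K ψ) (x : ι → K) {φ : 𝒢.Adelic → ℂ} (hφ : IsLeftInvariant 𝒢 φ)
    (u₀ : ↥𝒰.U) (g : 𝒢.Adelic) :
    𝒰.coeff ν 𝓕 ψ x φ ((u₀ : 𝒢.Adelic) * g) = 𝒰.globalCharFun ψ x u₀ * 𝒰.coeff ν 𝓕 ψ x φ g := by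
  -- the integrand at `g`
  set F : ↥𝒰.U → ℂ := fun u => φ ((u : 𝒢.Adelic) * g) * conj (𝒰.globalCharFun ψ x u) with hF
  have hconj : conj (𝒰.globalCharFun ψ x u₀) * 𝒰.globalCharFun ψ x u₀ = 1 := by
    rw [globalCharFun_eq, ← Complex.inv_eq_conj (𝒰.norm_charFun ψ _ u₀),
      inv_mul_cancel₀ (𝒰.charFun_ne_zero ψ _ u₀)]
  -- Step 1: the integrand at `u₀ g` is `u ↦ F (u u₀) ψ_x(u₀)`
  have h1 : ∫ u in 𝓕, φ ((u : 𝒢.Adelic) * ((u₀ : 𝒢.Adelic) * g)) * conj (𝒰.globalCharFun ψ x u) ∂ν =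
      ∫ u in 𝓕, F (u * u₀) * 𝒰.globalCharFun ψ x u₀ ∂ν := by
    refine integral_congr_ae (Filter.Eventually.of_forall fun u => ?_)
    simp only [hF, Subgroup.coe_mul, mul_assoc, globalCharFun_mul, map_mul]
    rw [hconj, mul_one]
  -- Step 2: change of variables `u ↦ u u₀` and the fundamental domain `𝓕 u₀`
  have h2 : ∫ u in 𝓕, F (u * u₀) ∂ν = ∫ u in (fun u => u * u₀) '' 𝓕, F u ∂ν :=
    ((measurePreserving_mul_right ν u₀).setIntegral_image_emb (measurableEmbedding_mulRight u₀)
      F 𝓕).symm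
  have h3 : (fun u => u * u₀) '' 𝓕 = MulOpposite.op u₀ • 𝓕 := rfl
  haveI : SMulCommClass (↥𝒰.U)ᵐᵒᵖ ↥𝒰.rationalPoints ↥𝒰.U := SMulCommClass.symm _ _ _
  have h𝓕' : IsFundamentalDomain ↥𝒰.rationalPoints (MulOpposite.op u₀ • 𝓕) ν :=
    h𝓕.smul_of_comm (MulOpposite.op u₀)
  have h4 : ∫ u in MulOpposite.op u₀ • 𝓕, F u ∂ν = ∫ u in 𝓕, F u ∂ν :=
    h𝓕'.setIntegral_eq h𝓕 (f := F) fun γ u => 𝒰.coeffIntegrand_smul hψ x hφ g γ u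
  rw [coeff, coeff, h1, integral_mul_const, h2, h3, h4, hF]
  simp only [Complex.real_smul]
  ring

/-- **`F_x(r(u₀) φ)(1) = ψ_x(u₀) F_x(φ)(1)`**: the functional `φ ↦ F_x(φ)(1)` is
`(U(𝔸_K), ψ_x)`-quasi-invariant under right translation (`coeff_rightTranslation` and
`coeff_mul_left`; Fleig et al. 2018, (6.39) and Remark 6.14). [cite: FleigEtAl2018, Def. 6.13, (6.39)] -/
theorem coeff_rightTranslation_one [BorelSpace ↥𝒰.U] [Countable ↥𝒰.rationalPoints]
    {ν : Measure ↥𝒰.U} [ν.IsMulRightInvariant] [MeasurableConstSMul ↥𝒰.rationalPoints ↥𝒰.U]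
    [SMulInvariantMeasure ↥𝒰.rationalPoints ↥𝒰.U ν] {𝓕 : Set ↥𝒰.U}
    (h𝓕 : IsFundamentalDomain ↥𝒰.rationalPoints 𝓕 ν) {ψ : AddChar (AdeleRing (𝓞 K) K) Circle}
    (hψ : IsGlobalAddChar K ψ) (x : ι → K) {φ : 𝒢.Adelic → ℂ} (hφ : IsLeftInvariant 𝒢 φ)
    (u₀ : ↥𝒰.U) :
    𝒰.coeff ν 𝓕 ψ x (rightTranslation 𝒢 u₀ φ) 1 = 𝒰.globalCharFun ψ x u₀ * 𝒰.coeff ν 𝓕 ψ x φ 1 := by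
  rw [coeff_rightTranslation, one_mul, ← 𝒰.coeff_mul_left h𝓕 hψ x hφ u₀ 1, mul_one]

/-- A non-zero coefficient forces `0 < ν 𝓕 < ∞` (otherwise the normalisation or the integral
vanishes). [folklore] -/
theorem measure_ne_zero_and_ne_top_of_coeff_ne_zero {ν : Measure ↥𝒰.U} {𝓕 : Set ↥𝒰.U}
    {ψ : AddChar (AdeleRing (𝓞 K) K) Circle} {x : ι → K} {φ : 𝒢.Adelic → ℂ} {g : 𝒢.Adelic}
    (h : 𝒰.coeff ν 𝓕 ψ x φ g ≠ 0) : ν 𝓕 ≠ 0 ∧ ν 𝓕 ≠ ⊤ := by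
  constructor
  · intro h0
    apply h
    rw [coeff, Measure.restrict_eq_zero.2 h0, integral_zero_measure, smul_zero]
  · intro htop
    apply h
    rw [coeff, htop, ENNReal.toReal_top, _root_.inv_zero, zero_smul]

/-- **`F_x` does not vanish identically on `W`** (`W` a set of functions on `G(𝔸_K)`, an automorphic
representation in applications): some `φ ∈ W` has `F_x(φ)(g) ≠ 0` for some `g`, the coefficient being
taken for some bi-invariant Haar measure `ν` on the (unimodular) group `U(𝔸_K)` and some measurable
fundamental domain `𝓕` of `U(K)` (then `0 < ν 𝓕 < ∞`, `measure_ne_zero_and_ne_top_of_coeff_ne_zero`;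
the value does not depend on `𝓕`, `coeff_eq_of_isFundamentalDomain`). This is "the functional
`F_x` is non-trivial on `W`" of Jiang–Liu–Savin 2016, Introduction (global wave-front set), and, for
`x` generic, "`W` has a non-zero Fourier coefficient attached to the orbit" (Fleig et al. 2018,
Def. 6.37; Ginzburg 2006). [cite: JiangLiuSavin2016, Introduction] -/
def HasNonzeroCoeff (ψ : AddChar (AdeleRing (𝓞 K) K) Circle) (W : Set (𝒢.Adelic → ℂ)) (x : ι → K) :
    Prop :=
  ∃ φ ∈ W, ∃ (ν : Measure ↥𝒰.U) (𝓕 : Set ↥𝒰.U) (g : 𝒢.Adelic),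
    ν.IsHaarMeasure ∧ ν.IsMulRightInvariant ∧ MeasurableSet 𝓕 ∧
      IsFundamentalDomain ↥𝒰.rationalPoints 𝓕 ν ∧ 𝒰.coeff ν 𝓕 ψ x φ g ≠ 0

/-- `HasNonzeroCoeff` is monotone in `W`. [folklore] -/
theorem HasNonzeroCoeff.mono {𝒰 : AdelicAbelianUnipotentDatum 𝒢 ι} [MeasurableSpace ↥𝒰.U]
    {ψ : AddChar (AdeleRing (𝓞 K) K) Circle} {W W' : Set (𝒢.Adelic → ℂ)} {x : ι → K}
    (h : 𝒰.HasNonzeroCoeff ψ W x) (hWW' : W ⊆ W') : 𝒰.HasNonzeroCoeff ψ W' x := by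
  obtain ⟨φ, hφ, ν, 𝓕, g, h⟩ := h
  exact ⟨φ, hWW' hφ, ν, 𝓕, g, h⟩

/-- The zero space has no non-zero coefficient. [folklore] -/
theorem not_hasNonzeroCoeff_zero (ψ : AddChar (AdeleRing (𝓞 K) K) Circle) (x : ι → K) :
    ¬ 𝒰.HasNonzeroCoeff ψ {(0 : 𝒢.Adelic → ℂ)} x := by
  rintro ⟨φ, hφ, ν, 𝓕, g, -, -, -, -, h⟩
  rw [Set.mem_singleton_iff] at hφ
  subst hφ
  exact h (𝒰.coeff_zero ν 𝓕 ψ x g)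

/-- **The wave-front support of `W` contains the orbit with generic representatives `generic`**:
some `x ∈ generic` has `F_x ≢ 0` on `W`. Here `generic ⊆ K^ι` is the set of rational points of the
dense Levi orbit on `𝔲₁^*` (for `E₈ ⊃ P_{α₅}`: the non-degenerate elements of Bhargava's
`K⁴ ⊗ ∧²K⁵`, orbit `E₈(a₇)`); with this choice the statement is "the orbit Fourier coefficient
(Fleig et al. 2018, Def. 6.37) is non-zero on `W`", i.e. the orbit belongs to the global wave-front
set of `W` (Jiang–Liu–Savin 2016, Introduction; Ginzburg 2006, the set `𝒪_G(π)` before maximality).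
[cite: FleigEtAl2018, Def. 6.34, Def. 6.37] -/
def WavefrontContains (ψ : AddChar (AdeleRing (𝓞 K) K) Circle) (generic : Set (ι → K))
    (W : Set (𝒢.Adelic → ℂ)) : Prop :=
  ∃ x ∈ generic, 𝒰.HasNonzeroCoeff ψ W x

/-- `WavefrontContains` is monotone in `W`. [folklore] -/
theorem WavefrontContains.mono {𝒰 : AdelicAbelianUnipotentDatum 𝒢 ι} [MeasurableSpace ↥𝒰.U]
    {ψ : AddChar (AdeleRing (𝓞 K) K) Circle} {generic : Set (ι → K)} {W W' : Set (𝒢.Adelic → ℂ)}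
    (h : 𝒰.WavefrontContains ψ generic W) (hWW' : W ⊆ W') : 𝒰.WavefrontContains ψ generic W' := by
  obtain ⟨x, hx, h⟩ := h
  exact ⟨x, hx, h.mono hWW'⟩

end Coeff

end CharGlobal

/-! ### Local pieces and the local–global glue -/

/-- A **local piece at the finite place `v`** of an adelic abelianised unipotent datum `𝒰`: the
factor embedding `ofLocal : G(K_v) →* G(𝔸_K)` (a section of the projection `𝒢.toLocal v`) and an
abelianised unipotent datum `(U_v ≤ G(K_v), coord_v : U_v → K_v^ι)` mapped by `ofLocal` into `U`
compatibly with the factor inclusion `K_v → 𝔸_K` of coordinates (`adeleSingleHom K v`). By intent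
`U_v = 𝐔(K_v)` with the same root coordinates (Fleig et al. 2018, Prop. 6.9: the character
"factorises into local places"; Jiang–Liu–Savin 2016, §5). [cite: FleigEtAl2018, Prop. 6.9] -/
structure LocalPiece (𝒰 : AdelicAbelianUnipotentDatum 𝒢 ι) (v : HeightOneSpectrum (𝓞 K)) where
  /-- The factor embedding `G(K_v) →* G(𝔸_K)`. -/
  ofLocal : 𝒢.Local v →* 𝒢.Adelic
  /-- `ofLocal` is a section of the projection onto the `v`-component. -/
  toLocal_ofLocal : ∀ g, 𝒢.toLocal v (ofLocal g) = g
  /-- The local abelianised unipotent datum `(U_v, coord_v)` in `G(K_v)`. -/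
  localDatum : AbelianUnipotentDatum (𝒢.Local v) (v.adicCompletion K) ι
  /-- `ofLocal` maps `U_v` into `U`. -/
  ofLocal_mem : ∀ u : ↥localDatum.U, ofLocal u ∈ 𝒰.U
  /-- Coordinates are compatible with the factor inclusion `K_v → 𝔸_K`. -/
  coordFun_ofLocal : ∀ u : ↥localDatum.U,
    𝒰.coordFun ⟨ofLocal u, ofLocal_mem u⟩ = fun i => adeleSingleHom K v (localDatum.coordFun u i)

namespace LocalPiece

variable {𝒰} {v : HeightOneSpectrum (𝓞 K)} (lp : 𝒰.LocalPiece v)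

/-- `ofLocal` is injective (it has the left inverse `toLocal v`). [folklore] -/
theorem ofLocal_injective : Function.Injective lp.ofLocal :=
  Function.LeftInverse.injective lp.toLocal_ofLocal

/-- The element of `U` defined by `u ∈ U_v`. [folklore] -/
def ofLocalU (u : ↥lp.localDatum.U) : ↥𝒰.U := ⟨lp.ofLocal u, lp.ofLocal_mem u⟩

/-- `(ofLocalU u : G(𝔸_K)) = ofLocal u`. [folklore] -/
@[simp] theorem coe_ofLocalU (u : ↥lp.localDatum.U) : (lp.ofLocalU u : 𝒢.Adelic) = lp.ofLocal u := rfl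

/-- The local coordinate vector `x ∈ K^ι` viewed in `K_v^ι`. [folklore] -/
def localCoords (v : HeightOneSpectrum (𝓞 K)) (x : ι → K) : ι → v.adicCompletion K :=
  fun i => algebraMap K (v.adicCompletion K) (x i)

/-- `(a)_𝔸 · ι_v(c) = ι_v(a c)` for `a ∈ K`, `c ∈ K_v` and the factor inclusion `ι_v = adeleSingleHom`
(Cassels–Fröhlich, Ch. II §14; the computation of `adicComponent_mulShift_algebraMap`, file
`AddCharConductorExponent`). [folklore] -/
theorem _root_.Literature.NumberTheory.Automorphic.algebraMap_mul_adeleSingleHom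
    (v : HeightOneSpectrum (𝓞 K)) (a : K) (c : v.adicCompletion K) :
    algebraMap K (AdeleRing (𝓞 K) K) a * adeleSingleHom K v c =
      adeleSingleHom K v (algebraMap K (v.adicCompletion K) a * c) := by
  classical
  refine Prod.ext ?_ ?_
  · change (algebraMap K (AdeleRing (𝓞 K) K) a).1 * (adeleSingleHom K v c).1 = (adeleSingleHom K v _).1
    rw [adeleSingleHom_apply_fst, adeleSingleHom_apply_fst, mul_zero]
  · change (algebraMap K (AdeleRing (𝓞 K) K) a).2 * (adeleSingleHom K v c).2 = (adeleSingleHom K v _).2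
    rw [adeleSingleHom_apply_snd, adeleSingleHom_apply_snd]
    refine FiniteAdeleRing.ext K fun w => ?_
    change (algebraMap K (AdeleRing (𝓞 K) K) a).2 w * finiteAdeleSingleHom K v c w =
      finiteAdeleSingleHom K v _ w
    by_cases hw : w = v
    · subst hw
      rw [finiteAdeleSingleHom_apply_self, finiteAdeleSingleHom_apply_self]
      rfl
    · rw [finiteAdeleSingleHom_apply_of_ne K v _ hw, finiteAdeleSingleHom_apply_of_ne K v _ hw,
        mul_zero]

variable [Fintype ι]

/-- **The global character restricts to the local one**: `ψ_x(ι_v(u)) = (ψ_v)_{x}(u)` for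
`u ∈ U_v`, where `ψ_v = ψ.adicComponent v` is the local component of `ψ` (Fleig et al. 2018,
Prop. 6.9: "It factorises into local places"). [cite: FleigEtAl2018, Prop. 6.9] -/
theorem globalCharFun_ofLocalU (ψ : AddChar (AdeleRing (𝓞 K) K) Circle) (x : ι → K)
    (u : ↥lp.localDatum.U) :
    𝒰.globalCharFun ψ x (lp.ofLocalU u) =
      lp.localDatum.charFun (ψ.adicComponent v) (localCoords v x) u := by
  rw [globalCharFun_eq, AbelianUnipotentDatum.charFun_apply, AbelianUnipotentDatum.charFun_apply,
    AddChar.adicComponent_apply]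
  congr 1
  have hc : 𝒰.coordFun (lp.ofLocalU u) = fun i => adeleSingleHom K v (lp.localDatum.coordFun u i) :=
    lp.coordFun_ofLocal u
  simp only [dotProduct, hc, adelicCoords_apply, localCoords, algebraMap_mul_adeleSingleHom, map_sum]

/-- **Local–global glue (algebraic form): a non-zero `(U(K_v), ψ_x)`-quasi-invariant functional on
a space of functions on `G(𝔸_K)` forces its local component at `v` to support `ψ_{x,v}`.**
Let `W' ≤ W` be subspaces of functions on `G(𝔸_K)` with `W` stable under right translation by
`ι_v(U_v)`, `Λ` a linear functional on `W` vanishing on `W'` with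
`Λ(r(ι_v u) φ) = ψ_x(ι_v u) Λ(φ)` (`u ∈ U_v`), and `f : V → W` a linear map intertwining a
representation `ρ` of `G(K_v)` with right translation modulo `W'` on `U_v` (the shape of the tree's
`AutomorphicRepData.HasLocalComponentAt`: `f (ρ u y) - r(ι_v u)(f y) ∈ W'`). If `Λ ∘ f ≠ 0` then
`J_{U_v, ψ_{x,v}}(ρ) ≠ 0`: indeed `Λ ∘ f` is a non-zero `(U_v, ψ_{x,v})`-quasi-invariant functional
on `V` (`globalCharFun_ofLocalU`, `supportsCharacter_iff_exists_functional`). With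
`Λ = F_x(·)(1)` — quasi-invariant by `F_x(φ)(u g) = ψ_x(u) F_x(φ)(g)` (Fleig et al. 2018, (6.39)) and
`coeff_rightTranslation` — this is the statement "a non-zero `ψ_x`-Fourier coefficient on
`R = ⊗'_v R_v` implies `(R_v)_{U,ψ_x} ≠ 0` for every `v`" (Jiang–Liu–Savin 2016, Introduction;
Ginzburg 2006). [cite: JiangLiuSavin2016, Introduction] -/
theorem supportsCharacter_of_localPiece {ψ : AddChar (AdeleRing (𝓞 K) K) Circle} {x : ι → K}
    {W W' : Submodule ℂ (𝒢.Adelic → ℂ)} (hW'W : W' ≤ W)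
    (hstab : ∀ (u : ↥lp.localDatum.U), ∀ φ ∈ W, rightTranslation 𝒢 (lp.ofLocal u) φ ∈ W)
    (Λ : ↥W →ₗ[ℂ] ℂ) (hΛW' : ∀ φ : ↥W, (φ : 𝒢.Adelic → ℂ) ∈ W' → Λ φ = 0)
    (hΛ : ∀ (u : ↥lp.localDatum.U) (φ : ↥W),
      Λ ⟨rightTranslation 𝒢 (lp.ofLocal u) φ, hstab u φ φ.2⟩ = 𝒰.globalCharFun ψ x (lp.ofLocalU u) * Λ φ)
    {V : Type*} [AddCommGroup V] [Module ℂ V] (ρ : Representation ℂ (𝒢.Local v) V)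
    (f : V →ₗ[ℂ] (𝒢.Adelic → ℂ)) (hfW : ∀ y, f y ∈ W)
    (hf : ∀ (u : ↥lp.localDatum.U) (y : V),
      f (ρ (u : 𝒢.Local v) y) - rightTranslation 𝒢 (lp.ofLocal u) (f y) ∈ W')
    (hΛf : ∃ y, Λ ⟨f y, hfW y⟩ ≠ 0) :
    lp.localDatum.SupportsCharacter ρ (ψ.adicComponent v) (localCoords v x) := by
  rw [AbelianUnipotentDatum.supportsCharacter_iff_exists_functional]
  -- the functional `Λ ∘ f` on `V`
  let fW : V →ₗ[ℂ] ↥W := LinearMap.codRestrict W f hfW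
  refine ⟨Λ ∘ₗ fW, ?_, fun u y => ?_⟩
  · obtain ⟨y, hy⟩ := hΛf
    intro h0
    exact hy (LinearMap.congr_fun h0 y)
  · have hdec : (fW (ρ (u : 𝒢.Local v) y) : ↥W) =
        ⟨rightTranslation 𝒢 (lp.ofLocal u) (f y), hstab u (f y) (hfW y)⟩ +
          ⟨f (ρ (u : 𝒢.Local v) y) - rightTranslation 𝒢 (lp.ofLocal u) (f y), hW'W (hf u y)⟩ := by
      refine Subtype.ext ?_
      simp [fW]
    rw [LinearMap.comp_apply, LinearMap.comp_apply, hdec, map_add, hΛW' ⟨_, hW'W (hf u y)⟩ (hf u y),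
      add_zero,
      hΛ u ⟨f y, hfW y⟩, globalCharFun_ofLocalU]
    rfl

/-- **Local–global glue, with the Fourier coefficient as the functional.** In the situation of
`supportsCharacter_of_localPiece` take `Λ = F_x(·)(1)` (`coeff ν 𝓕 ψ x · 1` for a right-invariant `ν`
and a fundamental domain `𝓕` of `U(K)`): it is linear on a space `W` of left `G(K)`-invariant functions
whose integrands are integrable on `𝓕` (`coeff_add`, `coeff_const_smul`) and `(U(𝔸_K), ψ_x)`-quasi-
invariant (`coeff_rightTranslation_one`). Hence: if `F_x(·)(1)` vanishes on `W'` (e.g. `W' = ⊥`) and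
`F_x(f y)(1) ≠ 0` for some vector `y` of a representation `ρ` of `G(K_v)` mapped into `W` by a
`U_v`-intertwiner `f` modulo `W'`, then `J_{U_v, ψ_{x,v}}(ρ) ≠ 0` — "a non-zero `ψ_x`-Fourier
coefficient on `R = ⊗'_v R_v` forces `R_v` to support `ψ_x`" (Jiang–Liu–Savin 2016, Introduction;
the remaining input in applications is Flath's factorisation, which provides `f` with
`F_x ∘ f ≠ 0` from `F_x ≢ 0` on `W`). [cite: JiangLiuSavin2016, Introduction] -/
theorem supportsCharacter_of_coeff_ne_zero [MeasurableSpace ↥𝒰.U] [BorelSpace ↥𝒰.U]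
    [Countable ↥𝒰.rationalPoints] {ν : Measure ↥𝒰.U} [ν.IsMulRightInvariant]
    [MeasurableConstSMul ↥𝒰.rationalPoints ↥𝒰.U] [SMulInvariantMeasure ↥𝒰.rationalPoints ↥𝒰.U ν]
    {𝓕 : Set ↥𝒰.U} (h𝓕 : IsFundamentalDomain ↥𝒰.rationalPoints 𝓕 ν)
    {ψ : AddChar (AdeleRing (𝓞 K) K) Circle} (hψ : IsGlobalAddChar K ψ) {x : ι → K}
    {W W' : Submodule ℂ (𝒢.Adelic → ℂ)} (hW'W : W' ≤ W) (hleft : ∀ φ ∈ W, IsLeftInvariant 𝒢 φ)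
    (hint : ∀ φ ∈ W, IntegrableOn
      (fun u : ↥𝒰.U => φ ((u : 𝒢.Adelic) * 1) * conj (𝒰.globalCharFun ψ x u)) 𝓕 ν)
    (hstab : ∀ (u : ↥lp.localDatum.U), ∀ φ ∈ W, rightTranslation 𝒢 (lp.ofLocal u) φ ∈ W)
    (hW' : ∀ φ ∈ W', 𝒰.coeff ν 𝓕 ψ x φ 1 = 0)
    {V : Type*} [AddCommGroup V] [Module ℂ V] (ρ : Representation ℂ (𝒢.Local v) V)
    (f : V →ₗ[ℂ] (𝒢.Adelic → ℂ)) (hfW : ∀ y, f y ∈ W)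
    (hf : ∀ (u : ↥lp.localDatum.U) (y : V),
      f (ρ (u : 𝒢.Local v) y) - rightTranslation 𝒢 (lp.ofLocal u) (f y) ∈ W')
    (hne : ∃ y, 𝒰.coeff ν 𝓕 ψ x (f y) 1 ≠ 0) :
    lp.localDatum.SupportsCharacter ρ (ψ.adicComponent v) (localCoords v x) := by
  -- the coefficient at `1` as a linear functional on `W`
  let Λ : ↥W →ₗ[ℂ] ℂ :=
    { toFun := fun φ => 𝒰.coeff ν 𝓕 ψ x φ 1
      map_add' := fun φ₁ φ₂ => 𝒰.coeff_add ν 𝓕 ψ x 1 (hint φ₁ φ₁.2) (hint φ₂ φ₂.2)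
      map_smul' := fun c φ => by
        rw [RingHom.id_apply, Submodule.coe_smul, coeff_const_smul, smul_eq_mul] }
  refine lp.supportsCharacter_of_localPiece hW'W hstab Λ (fun φ hφ => hW' φ hφ) (fun u φ => ?_) ρ f
    hfW hf hne
  change 𝒰.coeff ν 𝓕 ψ x (rightTranslation 𝒢 (lp.ofLocalU u : 𝒢.Adelic) φ) 1 =
    𝒰.globalCharFun ψ x (lp.ofLocalU u) * 𝒰.coeff ν 𝓕 ψ x φ 1
  exact 𝒰.coeff_rightTranslation_one h𝓕 hψ x (hleft φ φ.2) (lp.ofLocalU u)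

end LocalPiece

end AdelicAbelianUnipotentDatum

end Global

/-! ### The quintic instance: names for route `E8QuinticResidue` -/

section Quintic

variable {K : Type} [Field K] [NumberField K] {𝒢 : AdelicGroupData K}

/-- **`R` has a non-zero `x`-th quintic Fourier coefficient.** For the quintic coefficient datum
`𝒰` of split `E₈` over `K` (`U = U_{P_{α₅}}(𝔸_K)`, coordinates `U/[U,U] = 𝔲₁ ≅ K⁴ ⊗ ∧²K⁵` in
Bhargava's basis `QuinticIndex`, to be supplied by `defn-E8QuinticEisensteinDatum`), a set `R` of
functions on `E₈(𝔸_K)` (an automorphic representation) and `x ∈ K⁴ ⊗ ∧²K⁵` (coordinates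
`QuinticIndex → K` of the dual basis): `F_x ≢ 0` on `R` for Tate's character `ψ_K = adeleAddChar K`
(`HasNonzeroCoeff`). The cubic analogue on `G₂` (coefficients along the Heisenberg parabolic indexed
by cubic rings) is Gan–Gross–Savin 2002. [cite: FleigEtAl2018, Def. 6.13, Def. 6.37] -/
def HasNonzeroQuinticCoefficient (𝒰 : AdelicAbelianUnipotentDatum 𝒢 QuinticIndex)
    [MeasurableSpace ↥𝒰.U] (R : Set (𝒢.Adelic → ℂ)) (x : QuinticIndex → K) : Prop :=
  𝒰.HasNonzeroCoeff (adeleAddChar K) R x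

/-- Unfolding `HasNonzeroQuinticCoefficient`. [folklore] -/
theorem hasNonzeroQuinticCoefficient_iff (𝒰 : AdelicAbelianUnipotentDatum 𝒢 QuinticIndex)
    [MeasurableSpace ↥𝒰.U] (R : Set (𝒢.Adelic → ℂ)) (x : QuinticIndex → K) :
    HasNonzeroQuinticCoefficient 𝒰 R x ↔ 𝒰.HasNonzeroCoeff (adeleAddChar K) R x := Iff.rfl

/-- **`WF(R) ∋ E₈(a₇)`** in the sense needed by the route: some NON-DEGENERATE `x ∈ K⁴ ⊗ ∧²K⁵`
(`IsNondegenerate`, Bhargava's discriminant `≠ 0`, i.e. `x` in the dense `GL₄ × GL₅`-orbit whose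
rational points correspond to étale quintic `K`-algebras — to be supplied by
`defn-BhargavaQuinticSpace`) has a non-zero quintic Fourier coefficient on `R`: the orbit Fourier
coefficient attached to `E₈(a₇)` (the Richardson orbit of `P_{α₅}`, weighted Dynkin diagram `2` at
`α₅`, for which `V_𝒪 = U_{P_{α₅}}` and the generic characters are the non-degenerate `x`) does not
vanish on `R` (Fleig et al. 2018, Def. 6.34 and Def. 6.37; Jiang–Liu–Savin 2016, Introduction).
[cite: FleigEtAl2018, Def. 6.34, Def. 6.37] -/
def WFContainsE8a7 (𝒰 : AdelicAbelianUnipotentDatum 𝒢 QuinticIndex) [MeasurableSpace ↥𝒰.U]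
    (IsNondegenerate : (QuinticIndex → K) → Prop) (R : Set (𝒢.Adelic → ℂ)) : Prop :=
  𝒰.WavefrontContains (adeleAddChar K) {x | IsNondegenerate x} R

/-- Unfolding `WFContainsE8a7`: some non-degenerate `x` has a non-zero quintic coefficient on `R`.
[folklore] -/
theorem wfContainsE8a7_iff (𝒰 : AdelicAbelianUnipotentDatum 𝒢 QuinticIndex) [MeasurableSpace ↥𝒰.U]
    (IsNondegenerate : (QuinticIndex → K) → Prop) (R : Set (𝒢.Adelic → ℂ)) :
    WFContainsE8a7 𝒰 IsNondegenerate R ↔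
      ∃ x, IsNondegenerate x ∧ HasNonzeroQuinticCoefficient 𝒰 R x := by
  simp only [WFContainsE8a7, AdelicAbelianUnipotentDatum.WavefrontContains, Set.mem_setOf_eq,
    HasNonzeroQuinticCoefficient]

/-- **The smooth representation `J` of `E₈(F)` supports the quintic character `ψ_x`**, `x ∈ F⁴ ⊗
∧²F⁵` (`F = ℚ_p` in the route): `J_{U, ψ_x} ≠ 0` for the local quintic datum
`(U = U_{P_{α₅}}(F), coord : U → F^{QuinticIndex})` (`SupportsCharacter`); it only depends on the
Levi orbit of `x` (`SupportsCharacter.of_conj`), i.e. on the étale quintic `F`-algebra of `x`.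
[cite: JiangLiuSavin2016, Introduction and §5] -/
def SupportsQuinticCharacter {G : Type*} [Group G] {F : Type*} [CommRing F]
    (𝒰 : AbelianUnipotentDatum G F QuinticIndex) {V : Type*} [AddCommGroup V] [Module ℂ V]
    (J : Representation ℂ G V) (ψ : AddChar F Circle) (x : QuinticIndex → F) : Prop :=
  𝒰.SupportsCharacter J ψ x

/-- Unfolding `SupportsQuinticCharacter`. [folklore] -/
theorem supportsQuinticCharacter_iff {G : Type*} [Group G] {F : Type*} [CommRing F]
    (𝒰 : AbelianUnipotentDatum G F QuinticIndex) {V : Type*} [AddCommGroup V] [Module ℂ V]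
    (J : Representation ℂ G V) (ψ : AddChar F Circle) (x : QuinticIndex → F) :
    SupportsQuinticCharacter 𝒰 J ψ x ↔ 𝒰.SupportsCharacter J ψ x := Iff.rfl

/-- **Quintic local–global glue**: in the situation of `supportsCharacter_of_localPiece` for the
quintic datum and Tate's character, the local component at `v` supports the quintic character
`ψ_{x,v}` of `U(K_v)` (`x` read in `K_v⁴ ⊗ ∧²K_v⁵`). [cite: JiangLiuSavin2016, Introduction] -/
theorem supportsQuinticCharacter_of_localPiece {𝒰 : AdelicAbelianUnipotentDatum 𝒢 QuinticIndex}
    {v : HeightOneSpectrum (𝓞 K)} (lp : 𝒰.LocalPiece v) {x : QuinticIndex → K}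
    {W W' : Submodule ℂ (𝒢.Adelic → ℂ)} (hW'W : W' ≤ W)
    (hstab : ∀ (u : ↥lp.localDatum.U), ∀ φ ∈ W, rightTranslation 𝒢 (lp.ofLocal u) φ ∈ W)
    (Λ : ↥W →ₗ[ℂ] ℂ) (hΛW' : ∀ φ : ↥W, (φ : 𝒢.Adelic → ℂ) ∈ W' → Λ φ = 0)
    (hΛ : ∀ (u : ↥lp.localDatum.U) (φ : ↥W),
      Λ ⟨rightTranslation 𝒢 (lp.ofLocal u) φ, hstab u φ φ.2⟩ =
        𝒰.globalCharFun (adeleAddChar K) x (lp.ofLocalU u) * Λ φ)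
    {V : Type*} [AddCommGroup V] [Module ℂ V] (ρ : Representation ℂ (𝒢.Local v) V)
    (f : V →ₗ[ℂ] (𝒢.Adelic → ℂ)) (hfW : ∀ y, f y ∈ W)
    (hf : ∀ (u : ↥lp.localDatum.U) (y : V),
      f (ρ (u : 𝒢.Local v) y) - rightTranslation 𝒢 (lp.ofLocal u) (f y) ∈ W')
    (hΛf : ∃ y, Λ ⟨f y, hfW y⟩ ≠ 0) :
    SupportsQuinticCharacter lp.localDatum ρ ((adeleAddChar K).adicComponent v)
      (AdelicAbelianUnipotentDatum.LocalPiece.localCoords v x) :=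
  lp.supportsCharacter_of_localPiece hW'W hstab Λ hΛW' hΛ ρ f hfW hf hΛf

end Quintic

end Literature.NumberTheory.Automorphic
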